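import Summits.KontsevichZagierPeriods.KontsevichZagierPeriods.Theses.HurwitzMicroSectors
import Literature.NumberTheory.Transcendental.BoxIntegralHurwitzWeightTwo
import Literature.NumberTheory.Transcendental.BoxCoordinatePowerMap
import Literature.NumberTheory.Transcendental.KZMellinFibres
import Literature.NumberTheory.Transcendental.KZSubcalculusInvariants

/-!
# `SectorTwoSix` (stmt-KontsevichZagierPeriods-3870) — negative side: the load-bearing hypothesis,
# refuted strengthenings, and the load-bearing MOVE

Refuter (`cdisprove`) by-products for the crux `SectorTwoSix` of route `HurwitzMicroSectors`
(CDT's Theorem 1 ⇒ Conjecture 1 on the level-6 weight-2 box sector `[(0,1)², P(x₀x₁)/(1−(x₀x₁)⁶)]`).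
The crux itself is TRUE (sorry-free candidate proof attached to the item and kept in the crux work
file `Cruxes/SectorTwoSix/Disproof.lean` §7); this file records, as theorems, what ANY proof must use.

* §0 kit: the canonical sector representation `sectorRep P = [box, P(t)/(1−t⁶)]` (every `P ∈ ℚ[t]`
  is carried, so the crux's `∀ r` is not vacuous), `value_sectorRep_zero = 0`,
  `value_sectorRep_one_sub_X_pow_six = 1`, and the SYZYGY `value_pair_eq`:
  `[box, (1+t³)/(1−t⁶)]` and `[box, 4t/(1−t⁶)]` have equal values (`H₀ + H₃ = 4H₁`, the `m = 2`
  distribution relation, tree `BoxIntegral.level_six_relations`).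
* §1 the value hypothesis `r.value = r'.value` is load-bearing: `sectorTwoSix_false_without_value`
  (`P = 0` vs `P' = 1 − X⁶`, values `0 ≠ 1`, soundness `KZ.Equivalent.value_eq_holds`); with the CDT
  antecedent kept the mutilated crux is equivalent to `¬ CDT` (`withoutValue_imp_iff_not_cdt`), so it
  is not refutable in Lean short of proving CDT. The domain / `EqOn` clauses are scope restrictions
  (dropping them gives larger sub-cases of Conjecture 1, unrefutable by value).
* §2 refuted NATURAL STRENGTHENINGS: equal values force neither equal numerators
  (`not_sectorTwoSixInjective`) nor equal integrands on the box (`not_sectorTwoSixEqOn`): the pair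
  `1 + X³`, `4X`. The conclusion of the crux therefore needs genuine moves between different integrands.
* §3 the load-bearing MOVE: rule (1) (domain + integrand additivity) alone cannot prove the crux —
  `pair_not_mem_closure_add` (the tree's restricted evaluation `KZ.restrictedEval` over the corner
  `(0,¼)²` is an invariant of the additivity sub-calculus, `KZ.closure_add_le_ker_restrictedEval`, and
  gives the pair corner masses differing by `≥ 1/32`), packaged as `not_sectorTwoSixAdditive`: every
  proof uses a change of variables (rule 2) or a Newton–Leibniz move (rule 3).
* §4 TIGHTNESS: one rule-(2) generator suffices for the pair — `pair_mem_changeOfVariablesRel`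
  (the dilation `xᵢ ↦ xᵢ²`, analysis from `BoxCoordinatePowerMap.lean`), hence `pair_equivalent`.

Sources: M. Kontsevich, D. Zagier, *Periods* (2001), §1.2; F. Calegari, V. Dimitrov, Y. Tang (2024), Thm. 1.
-/

noncomputable section

open MeasureTheory Set Polynomial
open Literature.NumberTheory.Transcendental Literature.ModelTheory.ExponentialFields

namespace Summit.KontsevichZagierPeriods.Theorems.SectorTwoSix.Negative

open Summit.KontsevichZagierPeriods.KontsevichZagierPeriods.Theses.HurwitzMicroSectors (SectorTwoSix)

/-! ## §0 Kit: the canonical sector representations -/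

/-- The open unit box `(0,1)²`, literally as inlined in the crux. [folklore] -/
def box : Set (Fin 2 → ℝ) := {x | ∀ i, x i ∈ Set.Ioo (0:ℝ) 1}

/-- The sector integrand `P(x₀x₁)/(1 − (x₀x₁)⁶)`, literally as inlined in the crux. [folklore] -/
def sectorFun (P : ℚ[X]) (x : Fin 2 → ℝ) : ℝ :=
  Polynomial.aeval (x 0 * x 1) P / (1 - (x 0 * x 1) ^ 6)

/-- On the box `t = x₀x₁ ∈ (0,1)`. [folklore] -/
theorem mul_mem_Ioo {x : Fin 2 → ℝ} (hx : x ∈ box) : x 0 * x 1 ∈ Ioo (0:ℝ) 1 :=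
  BoxIntegral.mul_mem_Ioo_of_mem_box hx

/-- On the box the denominator `1 − t⁶` is positive. [folklore] -/
theorem den_pos {x : Fin 2 → ℝ} (hx : x ∈ box) : 0 < 1 - (x 0 * x 1) ^ 6 := by
  have ht := mul_mem_Ioo hx
  have : (x 0 * x 1) ^ 6 < 1 := pow_lt_one₀ ht.1.le ht.2 (by norm_num)
  linarith

/-- The two-variable numerator polynomial `P(X₀X₁)`. [folklore] -/
def numPoly (P : ℚ[X]) : MvPolynomial (Fin 2) ℚ :=
  Polynomial.aeval (MvPolynomial.X 0 * MvPolynomial.X 1 : MvPolynomial (Fin 2) ℚ) P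

/-- The denominator polynomial `1 − (X₀X₁)⁶`. [folklore] -/
def denPoly : MvPolynomial (Fin 2) ℚ := 1 - (MvPolynomial.X 0 * MvPolynomial.X 1) ^ 6

/-- Evaluation of `numPoly`. [folklore] -/
@[simp] theorem aeval_numPoly (P : ℚ[X]) (x : Fin 2 → ℝ) :
    MvPolynomial.aeval x (numPoly P) = Polynomial.aeval (x 0 * x 1) P := by
  unfold numPoly
  rw [← Polynomial.aeval_algHom_apply]
  simp

/-- Evaluation of `denPoly`. [folklore] -/
@[simp] theorem aeval_denPoly (x : Fin 2 → ℝ) :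
    MvPolynomial.aeval x denPoly = 1 - (x 0 * x 1) ^ 6 := by
  simp [denPoly]

/-- The sector integrand is integrable on the box: a finite `ℚ`-combination of the Hurwitz kernels
`tᵏ/(1 − t⁶)` (tree: `BoxIntegral.integrableOn_box_pow_div_one_sub_pow`). [folklore] -/
theorem integrableOn_sectorFun (P : ℚ[X]) : IntegrableOn (sectorFun P) box volume := by
  have hsum : IntegrableOn (fun x : Fin 2 → ℝ => ∑ i ∈ Finset.range (P.natDegree + 1),
      (P.coeff i : ℝ) * ((x 0 * x 1) ^ i / (1 - (x 0 * x 1) ^ 6))) box volume := by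
    refine integrable_finsetSum _ fun i _ => ?_
    exact (BoxIntegral.integrableOn_box_pow_div_one_sub_pow (by norm_num : 1 ≤ 6) i).const_mul _
  refine hsum.congr_fun (fun x _ => ?_) (BoxIntegral.measurableSet_box 2)
  simp only [sectorFun]
  rw [Polynomial.aeval_eq_sum_range, Finset.sum_div]
  refine Finset.sum_congr rfl fun i _ => ?_
  rw [Rat.smul_def, ← eq_ratCast (algebraMap ℚ ℝ), mul_div_assoc]

/-- **The canonical sector representation `[box, P(t)/(1 − t⁶)]`**, for every `P ∈ ℚ[t]`.
[folklore] -/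
def sectorRep (P : ℚ[X]) : KZ.IntegralRep 2 where
  domain := box
  integrand := sectorFun P
  isSemialgebraic_domain := KZ.isSemialgebraic_box 2
  isSemialgebraicFunOn_integrand :=
    (isSemialgebraicFunOn_aeval_div_aeval (KZ.isSemialgebraic_box 2) (numPoly P) denPoly
      (fun x hx => by rw [aeval_denPoly]; exact (den_pos hx).ne')).congr fun x _ => by
        simp only [aeval_numPoly, aeval_denPoly, sectorFun]
  integrableOn := integrableOn_sectorFun P

/-- The domain of `sectorRep P` is the box. [folklore] -/
@[simp] theorem sectorRep_domain (P : ℚ[X]) : (sectorRep P).domain = box := rfl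

/-- The integrand of `sectorRep P` is the sector integrand. [folklore] -/
@[simp] theorem sectorRep_integrand (P : ℚ[X]) : (sectorRep P).integrand = sectorFun P := rfl

/-- `sectorRep P` satisfies the crux's `EqOn` clause. [folklore] -/
theorem sectorRep_eqOn (P : ℚ[X]) :
    EqOn (sectorRep P).integrand (sectorFun P) (sectorRep P).domain := fun _ _ => rfl

/-- `[box, 0/(1−t⁶)]` has value `0`. [folklore] -/
theorem value_sectorRep_zero : (sectorRep 0).value = 0 := by
  simp only [KZ.IntegralRep.value, sectorRep_domain, sectorRep_integrand]
  have : sectorFun 0 = fun _ => 0 := by funext x; simp [sectorFun]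
  rw [this, integral_zero]

/-- `[box, (1−t⁶)/(1−t⁶)]` has value `1` (the box has volume `1`). [folklore] -/
theorem value_sectorRep_one_sub_X_pow_six : (sectorRep (1 - X ^ 6)).value = 1 := by
  simp only [KZ.IntegralRep.value, sectorRep_domain, sectorRep_integrand]
  refine (setIntegral_congr_fun (BoxIntegral.measurableSet_box 2) fun x hx => ?_).trans
    (BoxIntegral.setIntegral_box_const 2 1)
  have h := (den_pos hx).ne'
  simp only [sectorFun, map_sub, map_one, map_pow, Polynomial.aeval_X]
  rw [div_self h]

/-- The value of `[box, tᵏ/(1−t⁶)]` is the tree's Hurwitz box integral `H_k`. [folklore] -/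
theorem value_sectorRep_X_pow (k : ℕ) : (sectorRep (X ^ k)).value =
    ∫ x in {x : Fin 2 → ℝ | ∀ i, x i ∈ Ioo (0:ℝ) 1}, (x 0 * x 1) ^ k / (1 - (x 0 * x 1) ^ 6) := by
  simp only [KZ.IntegralRep.value, sectorRep_domain, sectorRep_integrand, box]
  refine setIntegral_congr_fun (BoxIntegral.measurableSet_box 2) fun x _ => ?_
  simp [sectorFun]

/-- Values are additive in the numerator. [folklore] -/
theorem value_sectorRep_add (P Q : ℚ[X]) :
    (sectorRep (P + Q)).value = (sectorRep P).value + (sectorRep Q).value := by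
  simp only [KZ.IntegralRep.value, sectorRep_domain, sectorRep_integrand]
  rw [← integral_add (integrableOn_sectorFun P) (integrableOn_sectorFun Q)]
  refine setIntegral_congr_fun (BoxIntegral.measurableSet_box 2) fun x _ => ?_
  simp only [sectorFun, map_add, add_div]

/-- Values scale with a numeral factor in the numerator. [folklore] -/
theorem value_sectorRep_ofNat_mul (n : ℕ) [n.AtLeastTwo] (P : ℚ[X]) :
    (sectorRep (OfNat.ofNat n * P)).value = (OfNat.ofNat n : ℝ) * (sectorRep P).value := by
  simp only [KZ.IntegralRep.value, sectorRep_domain, sectorRep_integrand]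
  rw [← integral_const_mul]
  refine setIntegral_congr_fun (BoxIntegral.measurableSet_box 2) fun x _ => ?_
  simp only [sectorFun, map_mul, map_ofNat, mul_div_assoc]

/-- **The syzygy**: `[box, (1+t³)/(1−t⁶)]` and `[box, 4t/(1−t⁶)]` have equal values
(`H₀ + H₃ = 4H₁`, the `m = 2` distribution relation; tree `BoxIntegral.level_six_relations`).
[folklore] -/
theorem value_pair_eq : (sectorRep (1 + X ^ 3)).value = (sectorRep (4 * X)).value := by
  obtain ⟨-, h03, -, -⟩ := BoxIntegral.level_six_relations
  rw [show (1 : ℚ[X]) = X ^ 0 from (pow_zero X).symm, value_sectorRep_add, value_sectorRep_X_pow,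
    value_sectorRep_X_pow, show (4 * X : ℚ[X]) = 4 * X ^ 1 by rw [pow_one], value_sectorRep_ofNat_mul,
    value_sectorRep_X_pow]
  exact_mod_cast h03

/-- The two numerators differ. [folklore] -/
theorem one_add_X_pow_three_ne : (1 + X ^ 3 : ℚ[X]) ≠ 4 * X := by
  intro h
  have := congrArg (fun p : ℚ[X] => p.coeff 0) h
  simp at this

/-! ## §1 The value hypothesis is load-bearing -/

/-- The crux with the hypothesis `r.value = r'.value` DELETED (everything else verbatim; the CDT
antecedent is dropped too, see `withoutValue_imp_iff_not_cdt` for the version keeping it); refuted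
below (a statement variant of this file, not a literature fact). -/
def SectorTwoSixWithoutValue : Prop :=
  ∀ (r r' : KZ.IntegralRep 2) (P P' : ℚ[X]), r.domain = {x | ∀ i, x i ∈ Set.Ioo (0:ℝ) 1} →
    r'.domain = {x | ∀ i, x i ∈ Set.Ioo (0:ℝ) 1} →
    EqOn r.integrand (fun x => Polynomial.aeval (x 0 * x 1) P / (1 - (x 0 * x 1) ^ 6)) r.domain →
    EqOn r'.integrand (fun x => Polynomial.aeval (x 0 * x 1) P' / (1 - (x 0 * x 1) ^ 6)) r'.domain →
    KZ.Equivalent r r'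

/-- **The value hypothesis is load-bearing** ("any proof must use it"): `[box, 0]` (`P = 0`) and
`[box, 1]` (`P' = 1 − X⁶`) lie in the sector with values `0 ≠ 1`, and the calculus is sound
(`KZ.Equivalent.value_eq_holds`). [folklore] -/
theorem sectorTwoSix_false_without_value : ¬ SectorTwoSixWithoutValue := by
  intro h
  have he := h (sectorRep 0) (sectorRep (1 - X ^ 6)) 0 (1 - X ^ 6) rfl rfl (sectorRep_eqOn _)
    (sectorRep_eqOn _)
  have hv := KZ.Equivalent.value_eq_holds he
  rw [value_sectorRep_zero, value_sectorRep_one_sub_X_pow_six] at hv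
  norm_num at hv

/-- Keeping the CDT antecedent does not rescue the mutilated crux: `CDT → SectorTwoSixWithoutValue`
is equivalent to `¬ CDT` (false in reality; refuting it in Lean means proving CDT's Theorem 1).
[folklore] -/
theorem withoutValue_imp_iff_not_cdt :
    ((LinearIndependent ℚ ![(1 : ℝ), Real.pi ^ 2,
        (∑' n : ℕ, (1 / (3 * (n : ℝ) + 1) ^ 2 - 1 / (3 * (n : ℝ) + 2) ^ 2))]) →
      SectorTwoSixWithoutValue) ↔
    ¬ LinearIndependent ℚ ![(1 : ℝ), Real.pi ^ 2,
        (∑' n : ℕ, (1 / (3 * (n : ℝ) + 1) ^ 2 - 1 / (3 * (n : ℝ) + 2) ^ 2))] :=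
  ⟨fun h hc => sectorTwoSix_false_without_value (h hc), fun h hc => absurd hc h⟩

/-! ## §2 Refuted natural strengthenings -/

/-- Strengthening I: equal values force equal numerators `P = P'` (value-rigidity of the whole
sector, which would make the crux a tautology); refuted below (a statement variant of this file,
not a literature fact). -/
def SectorTwoSixInjective : Prop :=
  ∀ (r r' : KZ.IntegralRep 2) (P P' : ℚ[X]), r.domain = {x | ∀ i, x i ∈ Set.Ioo (0:ℝ) 1} →
    r'.domain = {x | ∀ i, x i ∈ Set.Ioo (0:ℝ) 1} →
    EqOn r.integrand (fun x => Polynomial.aeval (x 0 * x 1) P / (1 - (x 0 * x 1) ^ 6)) r.domain →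
    EqOn r'.integrand (fun x => Polynomial.aeval (x 0 * x 1) P' / (1 - (x 0 * x 1) ^ 6)) r'.domain →
    r.value = r'.value → P = P'

/-- Strengthening II: equal values force the integrands to agree on the box; refuted below
(a statement variant of this file, not a literature fact). -/
def SectorTwoSixEqOn : Prop :=
  ∀ (r r' : KZ.IntegralRep 2) (P P' : ℚ[X]), r.domain = {x | ∀ i, x i ∈ Set.Ioo (0:ℝ) 1} →
    r'.domain = {x | ∀ i, x i ∈ Set.Ioo (0:ℝ) 1} →
    EqOn r.integrand (fun x => Polynomial.aeval (x 0 * x 1) P / (1 - (x 0 * x 1) ^ 6)) r.domain →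
    EqOn r'.integrand (fun x => Polynomial.aeval (x 0 * x 1) P' / (1 - (x 0 * x 1) ^ 6)) r'.domain →
    r.value = r'.value → EqOn r.integrand r'.integrand {x | ∀ i, x i ∈ Set.Ioo (0:ℝ) 1}

/-- Strengthening I is FALSE: the sector has syzygies (`[1 + t³]` and `[4t]` have equal values and
different numerators). [folklore] -/
theorem not_sectorTwoSixInjective : ¬ SectorTwoSixInjective := fun h =>
  one_add_X_pow_three_ne (h (sectorRep (1 + X ^ 3)) (sectorRep (4 * X)) _ _ rfl rfl
    (sectorRep_eqOn _) (sectorRep_eqOn _) value_pair_eq)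

/-- The centre `(½, ½)` of the box. [folklore] -/
theorem half_mem_box : (fun _ => (2⁻¹ : ℝ) : Fin 2 → ℝ) ∈ box := fun _ => by
  simp only [mem_Ioo]; norm_num

/-- At the centre the two integrands of the pair differ (`t = ¼`: `1 + t³ ≠ 4t`). [folklore] -/
theorem sectorFun_pair_ne_at_half :
    sectorFun (1 + X ^ 3) (fun _ => (2⁻¹ : ℝ)) ≠ sectorFun (4 * X) (fun _ => (2⁻¹ : ℝ)) := by
  simp only [sectorFun, map_add, map_one, map_pow, map_mul, map_ofNat, Polynomial.aeval_X]
  norm_num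

/-- Strengthening II is FALSE: equal values do not force equal integrands on the box. [folklore] -/
theorem not_sectorTwoSixEqOn : ¬ SectorTwoSixEqOn := fun h =>
  sectorFun_pair_ne_at_half (h (sectorRep (1 + X ^ 3)) (sectorRep (4 * X)) _ _ rfl rfl
    (sectorRep_eqOn _) (sectorRep_eqOn _) value_pair_eq half_mem_box)

/-! ## §3 The load-bearing MOVE: rule (1) alone cannot prove the crux -/

/-- The test windows: the corner `{x | ∀ i, xᵢ < ¼}` in every dimension. [folklore] -/
def corner (n : ℕ) : Set (Fin n → ℝ) := {x | ∀ i, x i < 4⁻¹}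

/-- The corners are the product windows `Iio ¼ ^ n` (hence measurable). [folklore] -/
theorem corner_eq_pi (n : ℕ) : corner n = Set.pi univ fun _ => Iio (4⁻¹ : ℝ) := by
  ext x; simp [corner]

/-- `box ∩ corner = (0,¼)²`. [folklore] -/
theorem box_inter_corner : box ∩ corner 2 = Set.pi univ fun _ => Ioo (0:ℝ) 4⁻¹ := by
  ext x
  simp only [box, corner, mem_inter_iff, mem_setOf_eq, mem_Ioo, mem_univ_pi]
  constructor
  · rintro ⟨h1, h2⟩ i
    exact ⟨(h1 i).1, h2 i⟩
  · intro h
    exact ⟨fun i => ⟨(h i).1, (h i).2.trans (by norm_num)⟩, fun i => (h i).2⟩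

/-- On `(0,¼)²`, `0 < t = x₀x₁ < 1/16`. [folklore] -/
theorem prod_bounds_of_mem_corner {x : Fin 2 → ℝ} (hx : x ∈ Set.pi univ fun _ => Ioo (0:ℝ) 4⁻¹) :
    0 < x 0 * x 1 ∧ x 0 * x 1 < 16⁻¹ := by
  rw [mem_univ_pi] at hx
  have h0 := hx 0; have h1 := hx 1
  refine ⟨mul_pos h0.1 h1.1, ?_⟩
  have := mul_lt_mul'' h0.2 h1.2 h0.1.le h1.1.le
  have h16 : (4⁻¹ : ℝ) * 4⁻¹ = 16⁻¹ := by norm_num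
  linarith

/-- **The corner separates the pair**: `∫_{(0,¼)²} ((1+t³) − 4t)/(1−t⁶) ≥ 1/32 > 0`, so
`[box, (1+t³)/(1−t⁶)] − [box, 4t/(1−t⁶)] ∉ closure (domainAddRel ∪ integrandAddRel)` (tree:
`KZ.closure_add_le_ker_restrictedEval`) — the distribution relation `H₀ + H₃ = 4H₁` is NOT an
additivity relation. [folklore] -/
theorem pair_not_mem_closure_add :
    KZ.of (sectorRep (1 + X ^ 3)) - KZ.of (sectorRep (4 * X)) ∉
      AddSubgroup.closure (KZ.domainAddRel ∪ KZ.integrandAddRel) := by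
  intro hmem
  have hmeas : ∀ n, MeasurableSet (corner n) := fun n => by
    rw [corner_eq_pi]; exact MeasurableSet.univ_pi fun _ => measurableSet_Iio
  have h0 := KZ.closure_add_le_ker_restrictedEval corner hmeas hmem
  rw [AddMonoidHom.mem_ker, map_sub, KZ.restrictedEval_of, KZ.restrictedEval_of, sectorRep_domain,
    sectorRep_domain, box_inter_corner] at h0
  set C : Set (Fin 2 → ℝ) := Set.pi univ fun _ => Ioo (0:ℝ) 4⁻¹ with hC
  have hCm : MeasurableSet C := MeasurableSet.univ_pi fun _ => measurableSet_Ioo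
  have hCsub : C ⊆ box := by
    intro x hx
    rw [hC, mem_univ_pi] at hx
    exact fun i => ⟨(hx i).1, (hx i).2.trans (by norm_num)⟩
  have hvol : volume C = ENNReal.ofReal 16⁻¹ := by
    rw [hC, volume_pi_pi]
    simp only [Real.volume_Ioo, Finset.prod_const, Finset.card_univ, Fintype.card_fin, sub_zero]
    rw [← ENNReal.ofReal_pow (by norm_num)]
    norm_num
  have hvolr : volume.real C = 16⁻¹ := by
    simp [Measure.real, hvol]
  have hi1 : IntegrableOn (sectorRep (1 + X ^ 3)).integrand C := (sectorRep _).integrableOn.mono_set hCsub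
  have hi2 : IntegrableOn (sectorRep (4 * X)).integrand C := (sectorRep _).integrableOn.mono_set hCsub
  have hsub : (∫ x in C, (sectorRep (1 + X ^ 3)).integrand x) -
      (∫ x in C, (sectorRep (4 * X)).integrand x) =
      ∫ x in C, ((sectorRep (1 + X ^ 3)).integrand x - (sectorRep (4 * X)).integrand x) :=
    (integral_sub hi1 hi2).symm
  have hconst : IntegrableOn (fun _ : Fin 2 → ℝ => (2⁻¹ : ℝ)) C := by
    refine integrableOn_const ?_
    rw [hvol]; exact ENNReal.ofReal_ne_top
  have hle : ∫ _ in C, (2⁻¹ : ℝ) ≤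
      ∫ x in C, ((sectorRep (1 + X ^ 3)).integrand x - (sectorRep (4 * X)).integrand x) := by
    refine setIntegral_mono_on hconst (hi1.sub hi2) hCm fun x hx => ?_
    obtain ⟨ht0, ht16⟩ := prod_bounds_of_mem_corner hx
    have hb : 0 < 1 - (x 0 * x 1) ^ 6 := den_pos (hCsub hx)
    have h3 : 0 ≤ (x 0 * x 1) ^ 3 := pow_nonneg ht0.le 3
    have h6 : 0 ≤ (x 0 * x 1) ^ 6 := pow_nonneg ht0.le 6
    simp only [sectorRep_integrand, sectorFun, map_add, map_one, map_pow, map_mul, map_ofNat,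
      Polynomial.aeval_X]
    rw [← sub_div, le_div_iff₀ hb]
    nlinarith
  have hcv : ∫ _ in C, (2⁻¹ : ℝ) = 32⁻¹ := by
    rw [setIntegral_const, hvolr]
    norm_num
  rw [hsub] at h0
  linarith

/-- Strengthening III (a SUB-CALCULUS): the crux with `KZ.relations` replaced by the subgroup
generated by the two additivity moves (rule 1) only, the CDT antecedent dropped; refuted below
(a statement variant of this file, not a literature fact). -/
def SectorTwoSixAdditive : Prop :=
  ∀ (r r' : KZ.IntegralRep 2) (P P' : ℚ[X]), r.domain = {x | ∀ i, x i ∈ Set.Ioo (0:ℝ) 1} →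
    r'.domain = {x | ∀ i, x i ∈ Set.Ioo (0:ℝ) 1} →
    EqOn r.integrand (fun x => Polynomial.aeval (x 0 * x 1) P / (1 - (x 0 * x 1) ^ 6)) r.domain →
    EqOn r'.integrand (fun x => Polynomial.aeval (x 0 * x 1) P' / (1 - (x 0 * x 1) ^ 6)) r'.domain →
    r.value = r'.value → KZ.of r - KZ.of r' ∈ AddSubgroup.closure (KZ.domainAddRel ∪ KZ.integrandAddRel)

/-- **Rule (1) is not enough**: an equal-valued pair of the sector lies outside the additivity-only
sub-calculus, so ANY proof of `SectorTwoSix` uses a change of variables (rule 2) or a Newton–Leibniz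
move (rule 3). (The candidate proof uses exactly rule 1b + four dilations `xᵢ ↦ xᵢ^m`.) [folklore] -/
theorem not_sectorTwoSixAdditive : ¬ SectorTwoSixAdditive := fun h =>
  pair_not_mem_closure_add (h (sectorRep (1 + X ^ 3)) (sectorRep (4 * X)) _ _ rfl rfl
    (sectorRep_eqOn _) (sectorRep_eqOn _) value_pair_eq)

/-! ## §4 Tightness: ONE change of variables connects the pair -/

/-- **One rule-(2) generator suffices**: `[box, 4t/(1−t⁶)] − [box, (1+t³)/(1−t⁶)]` IS a
change-of-variables move, the dilation `Φ(x) = (x₀², x₁²)` of the open box (polynomial hence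
`ℚ`-semialgebraic, injective with image the box, `|det Φ'| = 4x₀x₁`; tree
`BoxCoordinatePowerMap.lean`), since `(1+t³)/(1−t⁶) = 1/(1−t³)` pulls back to `4t/(1−t⁶)`.
[folklore] -/
theorem pair_mem_changeOfVariablesRel :
    KZ.of (sectorRep (4 * X)) - KZ.of (sectorRep (1 + X ^ 3)) ∈ KZ.changeOfVariablesRel := by
  refine ⟨2, sectorRep (4 * X), sectorRep (1 + X ^ 3), BoxIntegral.coordPow 2,
    BoxIntegral.coordPowDeriv 2, ?_, fun x _ => BoxIntegral.hasFDerivWithinAt_coordPow 2 _ x,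
    BoxIntegral.injOn_coordPow_box two_ne_zero, (BoxIntegral.image_coordPow_box two_ne_zero).symm,
    fun x hx => ?_, rfl⟩
  · exact (isSemialgebraicMapOn_aeval (KZ.isSemialgebraic_box 2) fun j => (MvPolynomial.X j) ^ 2).congr
      fun x _ => by ext j; simp
  · have hx' : ∀ i, x i ∈ Ioo (0:ℝ) 1 := hx
    have hd : 1 - (x 0 * x 1) ^ 6 ≠ 0 := (den_pos hx).ne'
    have ht := mul_mem_Ioo hx
    have hd2 : 1 - (x 0 ^ 2 * x 1 ^ 2) ^ 6 ≠ 0 := by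
      have h2 : x 0 ^ 2 * x 1 ^ 2 = (x 0 * x 1) ^ 2 := by ring
      have : (x 0 ^ 2 * x 1 ^ 2) ^ 6 < 1 := by
        rw [h2, ← pow_mul]
        exact pow_lt_one₀ ht.1.le ht.2 (by norm_num)
      linarith
    rw [BoxIntegral.abs_det_coordPowDeriv two_ne_zero hx']
    simp only [sectorRep_integrand, sectorFun, BoxIntegral.coordPow_apply, map_mul, map_ofNat,
      map_pow, Polynomial.aeval_X, map_add, map_one, Fin.prod_univ_two, Nat.add_one_sub_one, pow_one,
      Nat.cast_ofNat]
    rw [div_eq_iff hd, div_mul_eq_mul_div, div_mul_eq_mul_div, eq_div_iff hd2]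
    ring

/-- Hence the pair IS equivalent in the full calculus (by one move), while §3 shows that no chain
of rule-(1) moves connects it. [folklore] -/
theorem pair_equivalent : KZ.Equivalent (sectorRep (4 * X)) (sectorRep (1 + X ^ 3)) :=
  KZ.changeOfVariablesRel_subset_relations pair_mem_changeOfVariablesRel

end Summit.KontsevichZagierPeriods.Theorems.SectorTwoSix.Negative
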